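import Mathlib
import HarnessLib
import Summits.Ventures.LatticeQCDFlow.Exactness.JitteredHMCReversible
import Summits.Ventures.LatticeQCDFlow.Exactness.Phi4JitteredHMCMeasurableLabels
import Summits.Ventures.LatticeQCDFlow.Exactness.SUNOmfJitteredHMC

/-!
# Detailed balance of the engine's jittered φ⁴ (qpq / pqp) and `SU(N)` OMF2 / OMF4 HMC updates for EVERY law of the trajectory length — the continuous `tau_jitter` law included

HONEST FRAMING: exact (Metropolis-corrected) sampling algorithms for lattice gauge theory;
figures of merit are autocorrelation/cost numbers at stated couplings and volumes; no
continuum-physics claim.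

Venture `LatticeQCDFlow` (cell pub-lqcd), topic `Exactness`, FANOUT row 9 (eng-latcore, GEN-24; the engine's
`hmc.HMC(f, β, 'omf2' | 'omf4').trajectory(τ, nstep, tau_jitter)` and `phi4_2d.hmc(…, variant, tau_jitter)`).
NEW WORK of the cell over GEN-22's abstract `JitteredHMCReversible.lean` (`jitterHMC_isReversible`: the `η`-mixture
of involutive, `vol ⊗ volP`-preserving proposals sharing one Metropolis test on `S + T` is in detailed balance with
respect to `e^{−S}·vol`, for every probability law `η` on ANY measurable label space) and GEN-24's labelled kernels
`Phi4JitteredHMCMeasurableLabels.lean` (`phi4JitterHMCL`, `phi4JitterHMCLPQP`, `phi4LengthJitterHMC{,PQP}`) and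
`SUNOmfJitteredHMC.lean` (`sunOmf2JitterHMCL`, `sunOmf4JitterHMCL`, `wilsonOmf2JitterHMCL`, `wilsonOmf4JitterHMCL`),
whose exactness (`…_invariant`) was proved there through the involution / phase-volume facts of the tree
(`hmcProposal_involutive`, `measurePreserving_hmcProposal{,PQP}`, `palindromicWord_pow_isFlipReversible`,
`measurePreserving_palindromicWord`, `omf2_stages_…`, `omf4_stages_…`).  Nothing is cited as a fact; no number is
claimed.

WHY.  GEN-22 typed detailed balance of the jittered kernels for COUNTABLE label laws (`phi4JitterHMC_isReversible`,
`sunJitterHMCN_isReversible`); GEN-24 typed the kernels for an ARBITRARY label law (the idealised continuous uniform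
`tau_jitter` law has no atom) and their exactness.  Detailed balance is the stronger structural property the
autocorrelation theory of the cell uses (self-adjointness on `L²(π)`: `KernelAutocorrelation`, spectral bounds); this
file records it for every label law and every integrator the engine runs, by the same two facts per integrator that
gave exactness — so the continuous jitter costs nothing here either.

## Content

* **`phi4JitterHMCL_isReversible`**, **`phi4JitterHMCLPQP_isReversible`** — the labelled qpq / pqp φ⁴ kernels are
  `e^{−S}·Leb`-reversible for every label law; **`phi4LengthJitterHMC_isReversible`**,
  **`phi4LengthJitterHMCPQP_isReversible`** — `phi4_2d.hmc` AS RUN (label = drawn length, any Borel law on `ℝ`).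
* **`sunOmf2JitterHMCL_isReversible`**, **`sunOmf4JitterHMCL_isReversible`** — the labelled OMF2 / OMF4 kernels on
  `SU(N)^links` are `e^{−S}·Haar^{⊗links}`-reversible (every label law, coefficients, increments, `Z_T < ∞` not even
  needed for detailed balance of the sub-Markov formula — it is needed for Markovianity, proved in GEN-24).
* **`wilsonOmf2JitterHMCL_isReversible`**, **`wilsonOmf4JitterHMCL_isReversible`** — THE ENGINE'S `'omf2'` /
  `'omf4'` HMC AS RUN with `tau_jitter` of ANY law: detailed balance w.r.t. `wilsonMeasure (β/N)` on the torus
  `(ℤ/L)^d`, every coefficient choice (`lam`; `rho, theta, vth, lam`), every `nstep`.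

NOT CLAIMED: ergodicity of the OMF kernels for short trajectories (open: the kicked-product trajectory analysis of
gen-18 is typed for the leapfrog word only); any rate; floating point.
-/

noncomputable section

namespace Summit.Ventures.LatticeQCDFlow.Exactness

open MeasureTheory ProbabilityTheory ProbabilityTheory.Kernel Set Function
open Literature.MathematicalPhysics.QuantumFieldTheory
open Literature.MathematicalPhysics.QuantumLattice (fundamentalRep continuous_fundamentalRep)
open Summit.Ventures.LatticeQCDFlow.Scoring
open scoped ENNReal Matrix NNReal

/-! ## §1 Lattice φ⁴: the labelled qpq / pqp kernels and the engine as run -/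

section Phi4

variable {n : ℕ} {Lab : Type*} [MeasurableSpace Lab]
variable (J : Fin (n + 1) → Fin (n + 1) → ℝ) (lam : ℝ) {δ : Lab → ℝ} (hδ : Measurable δ) {N : Lab → ℕ}
  (hN : Measurable N) (η : Measure Lab)

/-- **THE LABELLED qpq φ⁴ KERNEL SATISFIES DETAILED BALANCE** w.r.t. `e^{−S}·Leb`, for every law of the label
(countable or not). -/
theorem phi4JitterHMCL_isReversible [IsProbabilityMeasure η] :
    IsReversible (phi4JitterHMCL J lam hδ hN η)
      ((volume : Measure (Fin (n + 1) → ℝ)).withDensity fun φ =>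
        ENNReal.ofReal (Real.exp (-latticePhi4Action J lam φ))) :=
  jitterHMC_isReversible (vol := (volume : Measure (Fin (n + 1) → ℝ))) (volP := (volume : Measure (Fin (n + 1) → ℝ)))
    η (continuous_latticePhi4Action J lam).measurable measurable_phi4Kinetic
    (fun l => hmcProposal_involutive J lam (δ l) (N l)) (fun l => measurePreserving_hmcProposal J lam (δ l) (N l))

/-- **THE LABELLED pqp φ⁴ KERNEL SATISFIES DETAILED BALANCE**, for every law of the label. -/
theorem phi4JitterHMCLPQP_isReversible [IsProbabilityMeasure η] :
    IsReversible (phi4JitterHMCLPQP J lam hδ hN η)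
      ((volume : Measure (Fin (n + 1) → ℝ)).withDensity fun φ =>
        ENNReal.ofReal (Real.exp (-latticePhi4Action J lam φ))) :=
  jitterHMC_isReversible (vol := (volume : Measure (Fin (n + 1) → ℝ))) (volP := (volume : Measure (Fin (n + 1) → ℝ)))
    η (continuous_latticePhi4Action J lam).measurable measurable_phi4Kinetic
    (fun l => hmcProposalPQP_involutive J lam (δ l) (N l))
    (fun l => measurePreserving_hmcProposalPQP J lam (δ l) (N l))

/-- **`phi4_2d.hmc(…, variant = 'qpq', tau_jitter)` AS RUN IS IN DETAILED BALANCE** w.r.t. `e^{−S}·Leb`, for every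
Borel probability law of the drawn trajectory length and every `nstep`. -/
theorem phi4LengthJitterHMC_isReversible (nstep : ℕ) (ηℓ : Measure ℝ) [IsProbabilityMeasure ηℓ] :
    IsReversible (phi4LengthJitterHMC J lam nstep ηℓ)
      ((volume : Measure (Fin (n + 1) → ℝ)).withDensity fun φ =>
        ENNReal.ofReal (Real.exp (-latticePhi4Action J lam φ))) := by
  unfold phi4LengthJitterHMC
  exact phi4JitterHMCL_isReversible J lam _ _ ηℓ

/-- **`phi4_2d.hmc(…, variant = 'pqp', tau_jitter)` AS RUN IS IN DETAILED BALANCE**, every law of the length. -/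
theorem phi4LengthJitterHMCPQP_isReversible (nstep : ℕ) (ηℓ : Measure ℝ) [IsProbabilityMeasure ηℓ] :
    IsReversible (phi4LengthJitterHMCPQP J lam nstep ηℓ)
      ((volume : Measure (Fin (n + 1) → ℝ)).withDensity fun φ =>
        ENNReal.ofReal (Real.exp (-latticePhi4Action J lam φ))) := by
  unfold phi4LengthJitterHMCPQP
  exact phi4JitterHMCLPQP_isReversible J lam _ _ ηℓ

end Phi4

/-! ## §2 `SU(N)^links`: the labelled OMF2 kernel -/

section Omf2
variable {n : Type*} [Fintype n] [DecidableEq n] {E : Type*} [NormedAddCommGroup E] [NormedSpace ℝ E]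
  [MeasurableSpace E] [BorelSpace E] [FiniteDimensional ℝ E]
variable (ι : E →ₗ[ℝ] Matrix n n ℂ) (hι : ∀ a, (ι a)ᴴ = -ι a ∧ (ι a).trace = 0)
variable {L : Type*} [Fintype L] (μ : Measure E) {T : (L → E) → ℝ} {Lab : Type*} [MeasurableSpace Lab]
variable {δ : Lab → ℝ} {hδ : Measurable δ} {g₁ g₂ : Lab → (L → Matrix.specialUnitaryGroup n ℂ) → L → E}
  {hg₁ : Measurable fun q : Lab × (L → Matrix.specialUnitaryGroup n ℂ) => g₁ q.1 q.2}
  {hg₂ : Measurable fun q : Lab × (L → Matrix.specialUnitaryGroup n ℂ) => g₂ q.1 q.2}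
  {S : (L → Matrix.specialUnitaryGroup n ℂ) → ℝ} {N : Lab → ℕ} {hN : Measurable N} {η : Measure Lab}

/-- **THE LABELLED OMF2 KERNEL ON `SU(N)^links` IS `e^{−S}·Haar^{⊗links}`-REVERSIBLE** — every law of the label,
every step / coefficient / increment assignment, every measurable action and kinetic term. -/
theorem sunOmf2JitterHMCL_isReversible [μ.IsAddHaarMeasure] [IsProbabilityMeasure η] (hT : Measurable T)
    (hS : Measurable S) :
    IsReversible (sunOmf2JitterHMCL ι hι μ T hδ hg₁ hg₂ S hN η)
      ((Measure.pi fun _ : L => haarProbability (Matrix.specialUnitaryGroup n ℂ)).withDensity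
        fun u => ENNReal.ofReal (Real.exp (-S u))) := by
  haveI := isNegInvariant_pi (L := L) μ
  refine jitterHMC_isReversible (vol := Measure.pi fun _ : L => haarProbability (Matrix.specialUnitaryGroup n ℂ))
    (volP := Measure.pi fun _ : L => μ) η hS hT (fun l => ?_) (fun l => ?_)
  · exact (palindromicWord_pow_isFlipReversible flip_mul_flip (kick_isFlipReversible (g₂ l))
      (omf2_stages_isFlipReversible (mulDrift_reversal (sunExpDrift_neg ι hι (δ l)))) (N l)).involutive
  · rw [Equiv.Perm.coe_mul]
    exact measurePreserving_flip.comp (measurePreserving_perm_pow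
      (measurePreserving_palindromicWord (measurePreserving_kick (hg₂.comp measurable_prodMk_left))
        (omf2_stages_measurePreserving (measurable_mulDrift (measurable_sunExpDrift ι hι (δ l)))
          (measurePreserving_mulDrift (sunExpDrift ι hι (δ l))) (hg₁.comp measurable_prodMk_left))) (N l))

end Omf2

/-! ## §3 `SU(N)^links`: the labelled OMF4 kernel -/

section Omf4
variable {n : Type*} [Fintype n] [DecidableEq n] {E : Type*} [NormedAddCommGroup E] [NormedSpace ℝ E]
  [MeasurableSpace E] [BorelSpace E] [FiniteDimensional ℝ E]
variable (ι : E →ₗ[ℝ] Matrix n n ℂ) (hι : ∀ a, (ι a)ᴴ = -ι a ∧ (ι a).trace = 0)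
variable {L : Type*} [Fintype L] (μ : Measure E) {T : (L → E) → ℝ} {Lab : Type*} [MeasurableSpace Lab]
variable {δ₁ δ₂ δ₃ : Lab → ℝ} {hδ₁ : Measurable δ₁} {hδ₂ : Measurable δ₂} {hδ₃ : Measurable δ₃}
  {g₁ g₂ g₃ : Lab → (L → Matrix.specialUnitaryGroup n ℂ) → L → E}
  {hg₁ : Measurable fun q : Lab × (L → Matrix.specialUnitaryGroup n ℂ) => g₁ q.1 q.2}
  {hg₂ : Measurable fun q : Lab × (L → Matrix.specialUnitaryGroup n ℂ) => g₂ q.1 q.2}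
  {hg₃ : Measurable fun q : Lab × (L → Matrix.specialUnitaryGroup n ℂ) => g₃ q.1 q.2}
  {S : (L → Matrix.specialUnitaryGroup n ℂ) → ℝ} {N : Lab → ℕ} {hN : Measurable N} {η : Measure Lab}

/-- **THE LABELLED OMF4 KERNEL ON `SU(N)^links` IS `e^{−S}·Haar^{⊗links}`-REVERSIBLE** — every law of the label,
every coefficient / increment assignment (11 stages per step), every measurable action and kinetic term. -/
theorem sunOmf4JitterHMCL_isReversible [μ.IsAddHaarMeasure] [IsProbabilityMeasure η] (hT : Measurable T)
    (hS : Measurable S) :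
    IsReversible (sunOmf4JitterHMCL ι hι μ T hδ₁ hδ₂ hδ₃ hg₁ hg₂ hg₃ S hN η)
      ((Measure.pi fun _ : L => haarProbability (Matrix.specialUnitaryGroup n ℂ)).withDensity
        fun u => ENNReal.ofReal (Real.exp (-S u))) := by
  haveI := isNegInvariant_pi (L := L) μ
  refine jitterHMC_isReversible (vol := Measure.pi fun _ : L => haarProbability (Matrix.specialUnitaryGroup n ℂ))
    (volP := Measure.pi fun _ : L => μ) η hS hT (fun l => ?_) (fun l => ?_)
  · exact (palindromicWord_pow_isFlipReversible flip_mul_flip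
      (drift_isFlipReversible (mulDrift_reversal (sunExpDrift_neg ι hι (δ₃ l))))
      (omf4_stages_isFlipReversible (mulDrift_reversal (sunExpDrift_neg ι hι (δ₁ l)))
        (mulDrift_reversal (sunExpDrift_neg ι hι (δ₂ l)))) (N l)).involutive
  · rw [Equiv.Perm.coe_mul]
    exact measurePreserving_flip.comp (measurePreserving_perm_pow
      (measurePreserving_palindromicWord
        (measurePreserving_drift (measurable_mulDrift (measurable_sunExpDrift ι hι (δ₃ l)))
          (measurePreserving_mulDrift (sunExpDrift ι hι (δ₃ l))))
        (omf4_stages_measurePreserving (measurable_mulDrift (measurable_sunExpDrift ι hι (δ₁ l)))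
          (measurePreserving_mulDrift (sunExpDrift ι hι (δ₁ l)))
          (measurable_mulDrift (measurable_sunExpDrift ι hι (δ₂ l))) (measurePreserving_mulDrift (sunExpDrift ι hι (δ₂ l)))
          (hg₁.comp measurable_prodMk_left) (hg₂.comp measurable_prodMk_left) (hg₃.comp measurable_prodMk_left))) (N l))

end Omf4

/-! ## §4 The engine's `'omf2'` / `'omf4'` HMC as run with `tau_jitter` of any law: detailed balance w.r.t. the Wilson measure -/

section Wilson
variable (N : ℕ) {d L : ℕ} [NeZero L]

/-- **THE ENGINE'S `'omf2'` HMC AS RUN, FOR A GENERAL LAW OF THE TRAJECTORY LENGTH, SATISFIES DETAILED BALANCE WITH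
RESPECT TO THE WILSON MEASURE** (`(β/N)·S_W` on the torus `(ℤ/L)^d`), every `lam`, every `nstep`, every Borel
probability law `η` of the length. -/
theorem wilsonOmf2JitterHMCL_isReversible [NeZero N] (β lam : ℝ) (nstep : ℕ) (η : Measure ℝ)
    [IsProbabilityMeasure η] :
    IsReversible (wilsonOmf2JitterHMCL N d L β lam nstep η)
      (wilsonMeasure (d := d) (L := L) (fundamentalRep (Fin N)) (β / N)) := by
  rw [← gibbsProbability_smul_wilsonAction_eq N (d := d) (L := L) (fundamentalRep (Fin N)) (β / N), gibbsProbability]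
  unfold wilsonOmf2JitterHMCL
  exact isReversible_smul (sunOmf2JitterHMCL_isReversible (sunCoordι N) (sunCoordι_skew N) Measure.addHaar
    (measurable_sunKinetic N) (measurable_engineWilsonAction N β)) _

/-- **THE ENGINE'S `'omf4'` HMC AS RUN, FOR A GENERAL LAW OF THE TRAJECTORY LENGTH, SATISFIES DETAILED BALANCE WITH
RESPECT TO THE WILSON MEASURE**, every coefficient choice `rho, theta, vth, lam`, every `nstep`, every law `η`. -/
theorem wilsonOmf4JitterHMCL_isReversible [NeZero N] (β rho theta vth lam : ℝ) (nstep : ℕ) (η : Measure ℝ)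
    [IsProbabilityMeasure η] :
    IsReversible (wilsonOmf4JitterHMCL N d L β rho theta vth lam nstep η)
      (wilsonMeasure (d := d) (L := L) (fundamentalRep (Fin N)) (β / N)) := by
  rw [← gibbsProbability_smul_wilsonAction_eq N (d := d) (L := L) (fundamentalRep (Fin N)) (β / N), gibbsProbability]
  unfold wilsonOmf4JitterHMCL
  exact isReversible_smul (sunOmf4JitterHMCL_isReversible (sunCoordι N) (sunCoordι_skew N) Measure.addHaar
    (measurable_sunKinetic N) (measurable_engineWilsonAction N β)) _

end Wilson

end Summit.Ventures.LatticeQCDFlow.Exactness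

end
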